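import Summits.ResolutionOfSingularities.ResolutionOfSingularities.Theorems.FrobeniusClosingPatchingRelPerfectDepthLegalTrace
import Literature.AlgebraicGeometry.Resolution.PrimeDivisorIdeals
import Literature.AlgebraicGeometry.Resolution.EtaleVanishingIdeal
import Literature.AlgebraicGeometry.Resolution.NormalCrossingsLocal
import Literature.AlgebraicGeometry.Resolution.MarkedIdealsEtale
import Literature.AlgebraicGeometry.Resolution.CoefficientIdealRestriction
import Literature.AlgebraicGeometry.Resolution.OrderSemicontinuityPointwise
import Literature.AlgebraicGeometry.Resolution.RegularCentreRsopGenerated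
import HarnessLib

/-!
# Crux `PatchingRelPerfect` (stmt-ResolutionOfSingularities-16161), chain W5.2 — T6-E1b residual `LegalScopedDivisorReduction₃`,
# PHASE 2 closer (2b), spec D2/D3 glue: the CURVE CENTRE over a codimension-one point of the host, restricted to the host

[OURS · L1 W5.2 · res-L1-w52-lead-1 g5, hand #3b; spec `L/res-L1-w52-lead-1/PHASE2-STEPB-SPEC.md` D2–D3] Replaces the role of NO printed
item; NOT a statement of the manuscript under review; fact-free.

A curve move of the separation game blows up `E` along `Z := cl{ι ζ}` for a codimension-one point `ζ` of the host `X = V(D)`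
(`ι : X ↪ E`). Brick B1's `HostState.trace_law` is stated with the restricted centre `𝓘_E(Z)|_X = (vanishingIdeal Z).comap ι`, the
order law (`…DepthLegalOrderLaw`) with the prime divisor ideal `𝓟_ζ = 𝓘_X(cl{ζ})`. This file identifies the two:

* `comap_subschemeι_vanishingIdeal` — for a closed immersion `ι = D.subschemeι` and a closed `Z ⊆ Supp D`:
  `(vanishingIdeal Z).comap ι = vanishingIdeal (ι⁻¹ Z)` (the restriction of a radical ideal containing `D` is radical);
* `comap_subschemeι_vanishingIdeal_closure` — `(𝓘_E(cl{ι ζ})).comap ι = 𝓟_ζ`;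
* `HostState.bd_le_pow_weight`, `HostState.weightAt_le_idealOrder_trace` — `M ≤ 𝓘_E(Z)^w` and `w ≤ ord_ζ (M|_X)` for `w` the
  boundary weight at the generic point of the regular centre `Z = cl{ι ζ}` (BGMW Lemma 3.2.1 (1) + upper semicontinuity of the order) —
  the hypotheses `1 ≤ w ≤ ord_ζ T` of the order law.

AI-written; AI review is weaker than expert review.

## References
* The Stacks Project, Tag 01J3 (reduced induced closed subscheme structure). [StacksProject]
* U. Görtz, T. Wedhorn, *Algebraic Geometry I*, 2nd ed. (2020), Def. 11.38–Thm. 11.40. [GortzWedhorn2020]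
-/

-- `Summit.<Summit>.<Sub>.Theorems` with `Sub = Summit` (single-conjunct summit, D-0017)
set_option linter.dupNamespace false

noncomputable section

open CategoryTheory CategoryTheory.Limits AlgebraicGeometry TopologicalSpace IsLocalRing
open Literature.AlgebraicGeometry.Resolution Scheme.IdealSheafData

namespace Summit.ResolutionOfSingularities.ResolutionOfSingularities.Theorems

universe u

namespace DepthLegal

variable {E : Scheme.{u}} {D : E.IdealSheafData}

/-- **The restriction to `V(D)` of the ideal of a reduced closed `Z ⊆ Supp D` is the ideal of `Z` in `V(D)`**: it is radical (the image,
under the surjective stalk maps of the closed immersion, of a radical ideal containing their kernel `D`) with support `ι⁻¹ Z`.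
[cite: StacksProject, Tag 01J3] -/
theorem comap_subschemeι_vanishingIdeal (Z : Closeds E) (hZ : (Z : Set E) ⊆ D.support) :
    (vanishingIdeal Z).comap D.subschemeι = vanishingIdeal (Z.preimage D.subschemeι.continuous) := by
  apply eq_vanishingIdeal_of_radical
  · rw [radical_eq_iff_forall_stalkIdeal]
    intro x
    rw [stalkIdeal_comap_eq_map]
    have hsurj : Function.Surjective (D.subschemeι.stalkMap x).hom := D.subschemeι.stalkMap_surjective x
    have hker : RingHom.ker (D.subschemeι.stalkMap x).hom ≤ stalkIdeal (vanishingIdeal Z) (D.subschemeι x) := by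
      rw [ker_stalkMap_subschemeι]
      exact stalkIdeal_mono (Scheme.IdealSheafData.le_support_iff_le_vanishingIdeal.mp hZ) _
    have hrad : (stalkIdeal (vanishingIdeal Z) (D.subschemeι x)).IsRadical := isRadical_stalkIdeal_vanishingIdeal Z _
    -- the image of a radical ideal containing the kernel is radical
    show ((stalkIdeal (vanishingIdeal Z) (D.subschemeι x)).map (D.subschemeι.stalkMap x).hom).IsRadical
    rw [Ideal.IsRadical, ← Ideal.map_radical_of_surjective hsurj hker, hrad.radical]
  · apply Closeds.ext
    rw [support_comap]
    rfl

/-- **`(𝓘_E(cl{ι ζ})).comap ι = 𝓟_ζ`** for a point `ζ` of the host `V(D)`: the restricted centre of a curve move is the prime divisor ideal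
of `ζ` on the host. [cite: GortzWedhorn2020, Def. 11.38] -/
theorem comap_subschemeι_vanishingIdeal_closure (ζ : D.subscheme) :
    (vanishingIdeal ⟨closure {D.subschemeι ζ}, isClosed_closure⟩).comap D.subschemeι = primeDivisorIdeal ζ := by
  have hZ : (closure {D.subschemeι ζ} : Set E) ⊆ D.support :=
    closure_minimal (Set.singleton_subset_iff.mpr (subschemeι_apply_mem_support D ζ)) D.support.isClosed
  rw [comap_subschemeι_vanishingIdeal ⟨closure {D.subschemeι ζ}, isClosed_closure⟩ hZ, primeDivisorIdeal]
  congr 1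
  apply Closeds.ext
  change D.subschemeι ⁻¹' closure {D.subschemeι ζ} = closure {ζ}
  rw [D.subschemeι.isClosedEmbedding.isInducing.closure_eq_preimage_closure_image, Set.image_singleton]

namespace HostState

variable [IsLocallyNoetherian E] {H : E.IdealSheafData} {L : List (E.IdealSheafData × ℕ)} (S : HostState H D L)
  {Z : Closeds E} {η : E}

include S in
/-- **`M ≤ 𝓘(Z)^w`, `w = weightAt L η`**, for a regular irreducible centre `Z` with generic point `η`: the order of the boundary monomial is `w` at
`η` (snc boundary) hence `≥ w` along `Z` (upper semicontinuity on the regular `E`), and `𝓘(Z)^w` collects every ideal of order `≥ w` along the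
regular centre. [cite: BierstoneGrigorievMilmanWlodarczyk2011, Lemma 3.2.1 (1)] -/
theorem bd_le_pow_weight (hη : IsGenericPoint η (Z : Set E)) (hZ : Scheme.IsRegular (vanishingIdeal Z).subscheme) :
    monomialIdeal L ≤ vanishingIdeal Z ^ weightAt L η := by
  refine le_pow_of_isRegular_subscheme_of_forall_le_idealOrder_of_isRegular S.regE hZ fun y hy => ?_
  haveI : IsRegularLocalRing (E.presheaf.stalk y) := S.regE y
  have hyZ : y ∈ (Z : Set E) := by
    have h : y ∈ ((vanishingIdeal Z).support : Set E) := hy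
    rwa [Scheme.IdealSheafData.coe_support_vanishingIdeal] at h
  have hηord : (weightAt L η : ℕ∞) ≤ idealOrder (monomialIdeal L) η := (le_idealOrder_monomialIdeal_iff S.sncB _ η).mpr le_rfl
  exact hηord.trans (idealOrder_le_of_specializes (hη.specializes hyZ) _)

include S in
/-- **`w ≤ ord_ζ (M|_X)`** for the curve centre `Z = cl{ι ζ}` over a point `ζ` of the host (regular as a subscheme): restrict `M ≤ 𝓘(Z)^w` to the
host, where `𝓘(Z)|_X = 𝓟_ζ ≤ 𝔪_ζ`. [cite: BierstoneGrigorievMilmanWlodarczyk2011, Lemma 3.2.1 (1)] -/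
theorem weightAt_le_idealOrder_trace (ζ : D.subscheme)
    (hZ : Scheme.IsRegular (vanishingIdeal ⟨closure {D.subschemeι ζ}, isClosed_closure⟩).subscheme) :
    (weightAt L (D.subschemeι ζ) : ℕ∞) ≤ idealOrder ((monomialIdeal L).comap D.subschemeι) ζ := by
  have hη : IsGenericPoint (D.subschemeι ζ) ((⟨closure {D.subschemeι ζ}, isClosed_closure⟩ : Closeds E) : Set E) :=
    isGenericPoint_closure
  have hle := S.bd_le_pow_weight hη hZ
  have hle' : (monomialIdeal L).comap D.subschemeι ≤ primeDivisorIdeal ζ ^ weightAt L (D.subschemeι ζ) := by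
    rw [← comap_subschemeι_vanishingIdeal_closure ζ, ← comap_pow]
    exact Scheme.IdealSheafData.comap_mono (f := D.subschemeι) hle
  rw [le_idealOrder_iff]
  refine (stalkIdeal_mono hle' ζ).trans ?_
  rw [stalkIdeal_pow, stalkIdeal_primeDivisorIdeal_self]

end HostState

end DepthLegal

end Summit.ResolutionOfSingularities.ResolutionOfSingularities.Theorems

end
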